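import Summits.Ventures.PercRepro.S1CFGTriangles
import Summits.Ventures.PercRepro.S1CFGFourCircuits

/-!
# PercRepro — THE SHARPENED SIMPLE CHAIN AT NULLITY `3` AND `4`, BY NUMBER (p1, gen 39; feeder of S2's row `p = 12`)

The low-rank set counts of a SIMPLE (no dependent pair) coloop-free matroid of nullity `ν` on `n` points with the triangle
cap (S1CFGTriangles) and the `4`-circuit averaging cap (S1CFGFourCircuits) pushed through the landed double counts — the
N-side vectors of the regime `ν = 4` of the cells `(12, 7)` and `(12, 8)` (`Q_k^s = #{X ⊆ E : |X| = k, rk X ≤ s}`,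
`c₄ = #{4-circuits}`):

| `(ν, n)` | `c₃` | `Q₄²` | `c₄` | `D₄` | `Q₅²` | `Q₅³` | `Q₅⁴` |
|---|---|---|---|---|---|---|---|
| (3, 10) | 5 | 1 | 8 | 43 | 0 | 9 | 118 |
| (3, 11) | 5 | 1 | 7 | 47 | 0 | 10 | 179 |
| (4, 11) | 11 | 5 | 23 | 111 | 1 | 51 | 286 |
| (4, 12) | 11 | 5 | 22 | 121 | 1 | 56 | 418 |

`chain_three_ten`, `chain_three_eleven`, `chain_four_eleven`, `chain_four_twelve` — one conjunction each.
Nothing about any cell is claimed. Axioms: standard.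
-/

open scoped Matroid

namespace PercRepro

namespace S1CFG

open Set S1CF

variable {α : Type}

/-- The triangle cap at nullity `3` on `≥ 8` points: `c₃ ≤ 5` (the landed cap: `10`). -/
theorem triangles_le_five_of_nullity_three (M : Matroid α) [M.Finite]
    (hd : M.E.encard = M.eRank + ((3 : ℕ) : ℕ∞)) (hK : ∀ e, ¬ M.IsColoop e)
    (h0 : {P : Set α | P ⊆ M.E ∧ P.ncard = 2 ∧ M.Dep P}.ncard = 0) (hn : 8 ≤ M.E.ncard) :
    {X : Set α | X ⊆ M.E ∧ X.ncard = 3 ∧ M.eRk X ≤ 2}.ncard ≤ 5 := by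
  have h := ncard_three_eRk_le_two_le_choose_succ_add_one M hd hK h0 (by omega)
  exact h.trans (by decide)

/-- **The chain at `(ν, n) = (3, 10)`**: `c₃ ≤ 5`, `Q₄² ≤ 1`, `c₄ ≤ 8`, `D₄ ≤ 43`, `Q₅² ≤ 0`, `Q₅³ ≤ 9`, `Q₅⁴ ≤ 118`. -/
theorem chain_three_ten (M : Matroid α) [M.Finite] (hK : ∀ e, ¬ M.IsColoop e)
    (hd : M.E.encard = M.eRank + ((3 : ℕ) : ℕ∞))
    (h0 : {P : Set α | P ⊆ M.E ∧ P.ncard = 2 ∧ M.Dep P}.ncard = 0) (hn : M.E.ncard = 10) :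
    {X : Set α | X ⊆ M.E ∧ X.ncard = 3 ∧ M.eRk X ≤ 2}.ncard ≤ 5 ∧
    {X : Set α | X ⊆ M.E ∧ X.ncard = 4 ∧ M.eRk X ≤ 2}.ncard ≤ 1 ∧
    {X : Set α | X ⊆ M.E ∧ X.ncard = 4 ∧ M.IsCircuit X}.ncard ≤ 8 ∧
    {X : Set α | X ⊆ M.E ∧ X.ncard = 4 ∧ M.eRk X ≤ 3}.ncard ≤ 43 ∧
    {X : Set α | X ⊆ M.E ∧ X.ncard = 5 ∧ M.eRk X ≤ 2}.ncard ≤ 0 ∧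
    {X : Set α | X ⊆ M.E ∧ X.ncard = 5 ∧ M.eRk X ≤ 3}.ncard ≤ 9 ∧
    {X : Set α | X ⊆ M.E ∧ X.ncard = 5 ∧ M.eRk X ≤ 4}.ncard ≤ 118 := by
  have hr : (M.eRk M.E).toNat = 7 := by
    have := ncard_ground_eq_eRk_toNat_add M hd
    omega
  have h3 := triangles_le_five_of_nullity_three M hd hK h0 (by omega)
  have h42 := four_mul_ncard_four_eRk_le_two_le_mul M hK hd h0 (by omega)
  have h4 := ncard_fourCircuits_le_div M hK hd (by omega)
  have h4' : {X : Set α | X ⊆ M.E ∧ X.ncard = 4 ∧ M.IsCircuit X}.ncard ≤ 8 := by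
    rw [hn] at h4
    exact h4.trans (by decide)
  have hD4 := ncard_four_eRk_le_three_le_add M h0
  have h52 := five_mul_ncard_five_eRk_le_two_le_of_no_dep_pair M hK hd h0 (by omega)
  have h53 := five_mul_ncard_five_eRk_le_three_le M hK hd (by omega)
  have h54 := five_mul_ncard_five_eRk_le_four_le_exact M hK hd (by omega)
  rw [hn] at hD4 h53 h54
  rw [show Nat.choose 10 4 = 210 by decide] at h54
  omega

/-- **The chain at `(ν, n) = (3, 11)`**: `c₃ ≤ 5`, `Q₄² ≤ 1`, `c₄ ≤ 7`, `D₄ ≤ 47`, `Q₅² ≤ 0`, `Q₅³ ≤ 10`, `Q₅⁴ ≤ 179`. -/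
theorem chain_three_eleven (M : Matroid α) [M.Finite] (hK : ∀ e, ¬ M.IsColoop e)
    (hd : M.E.encard = M.eRank + ((3 : ℕ) : ℕ∞))
    (h0 : {P : Set α | P ⊆ M.E ∧ P.ncard = 2 ∧ M.Dep P}.ncard = 0) (hn : M.E.ncard = 11) :
    {X : Set α | X ⊆ M.E ∧ X.ncard = 3 ∧ M.eRk X ≤ 2}.ncard ≤ 5 ∧
    {X : Set α | X ⊆ M.E ∧ X.ncard = 4 ∧ M.eRk X ≤ 2}.ncard ≤ 1 ∧
    {X : Set α | X ⊆ M.E ∧ X.ncard = 4 ∧ M.IsCircuit X}.ncard ≤ 7 ∧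
    {X : Set α | X ⊆ M.E ∧ X.ncard = 4 ∧ M.eRk X ≤ 3}.ncard ≤ 47 ∧
    {X : Set α | X ⊆ M.E ∧ X.ncard = 5 ∧ M.eRk X ≤ 2}.ncard ≤ 0 ∧
    {X : Set α | X ⊆ M.E ∧ X.ncard = 5 ∧ M.eRk X ≤ 3}.ncard ≤ 10 ∧
    {X : Set α | X ⊆ M.E ∧ X.ncard = 5 ∧ M.eRk X ≤ 4}.ncard ≤ 179 := by
  have hr : (M.eRk M.E).toNat = 8 := by
    have := ncard_ground_eq_eRk_toNat_add M hd
    omega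
  have h3 := triangles_le_five_of_nullity_three M hd hK h0 (by omega)
  have h42 := four_mul_ncard_four_eRk_le_two_le_mul M hK hd h0 (by omega)
  have h4 := ncard_fourCircuits_le_div M hK hd (by omega)
  have h4' : {X : Set α | X ⊆ M.E ∧ X.ncard = 4 ∧ M.IsCircuit X}.ncard ≤ 7 := by
    rw [hn] at h4
    exact h4.trans (by decide)
  have hD4 := ncard_four_eRk_le_three_le_add M h0
  have h52 := five_mul_ncard_five_eRk_le_two_le_of_no_dep_pair M hK hd h0 (by omega)
  have h53 := five_mul_ncard_five_eRk_le_three_le M hK hd (by omega)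
  have h54 := five_mul_ncard_five_eRk_le_four_le_exact M hK hd (by omega)
  rw [hn] at hD4 h53 h54
  rw [show Nat.choose 11 4 = 330 by decide] at h54
  omega

/-- **The chain at `(ν, n) = (4, 11)`**: `c₃ ≤ 11`, `Q₄² ≤ 5`, `c₄ ≤ 23`, `D₄ ≤ 111`, `Q₅² ≤ 1`, `Q₅³ ≤ 51`, `Q₅⁴ ≤ 286`. -/
theorem chain_four_eleven (M : Matroid α) [M.Finite] (hK : ∀ e, ¬ M.IsColoop e)
    (hd : M.E.encard = M.eRank + ((4 : ℕ) : ℕ∞))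
    (h0 : {P : Set α | P ⊆ M.E ∧ P.ncard = 2 ∧ M.Dep P}.ncard = 0) (hn : M.E.ncard = 11) :
    {X : Set α | X ⊆ M.E ∧ X.ncard = 3 ∧ M.eRk X ≤ 2}.ncard ≤ 11 ∧
    {X : Set α | X ⊆ M.E ∧ X.ncard = 4 ∧ M.eRk X ≤ 2}.ncard ≤ 5 ∧
    {X : Set α | X ⊆ M.E ∧ X.ncard = 4 ∧ M.IsCircuit X}.ncard ≤ 23 ∧
    {X : Set α | X ⊆ M.E ∧ X.ncard = 4 ∧ M.eRk X ≤ 3}.ncard ≤ 111 ∧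
    {X : Set α | X ⊆ M.E ∧ X.ncard = 5 ∧ M.eRk X ≤ 2}.ncard ≤ 1 ∧
    {X : Set α | X ⊆ M.E ∧ X.ncard = 5 ∧ M.eRk X ≤ 3}.ncard ≤ 51 ∧
    {X : Set α | X ⊆ M.E ∧ X.ncard = 5 ∧ M.eRk X ≤ 4}.ncard ≤ 286 := by
  have hr : (M.eRk M.E).toNat = 7 := by
    have := ncard_ground_eq_eRk_toNat_add M hd
    omega
  have h3 := triangles_le_eleven_of_nullity_four M hd hK h0 (by omega)
  have h42 := four_mul_ncard_four_eRk_le_two_le_mul M hK hd h0 (by omega)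
  have h4 := ncard_fourCircuits_le_div M hK hd (by omega)
  have h4' : {X : Set α | X ⊆ M.E ∧ X.ncard = 4 ∧ M.IsCircuit X}.ncard ≤ 23 := by
    rw [hn] at h4
    exact h4.trans (by decide)
  have hD4 := ncard_four_eRk_le_three_le_add M h0
  have h52 := five_mul_ncard_five_eRk_le_two_le_of_no_dep_pair M hK hd h0 (by omega)
  have h53 := five_mul_ncard_five_eRk_le_three_le M hK hd (by omega)
  have h54 := five_mul_ncard_five_eRk_le_four_le_exact M hK hd (by omega)
  rw [hn] at hD4 h53 h54
  rw [show Nat.choose 11 4 = 330 by decide] at h54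
  omega

/-- **The chain at `(ν, n) = (4, 12)`**: `c₃ ≤ 11`, `Q₄² ≤ 5`, `c₄ ≤ 22`, `D₄ ≤ 121`, `Q₅² ≤ 1`, `Q₅³ ≤ 56`, `Q₅⁴ ≤ 418`. -/
theorem chain_four_twelve (M : Matroid α) [M.Finite] (hK : ∀ e, ¬ M.IsColoop e)
    (hd : M.E.encard = M.eRank + ((4 : ℕ) : ℕ∞))
    (h0 : {P : Set α | P ⊆ M.E ∧ P.ncard = 2 ∧ M.Dep P}.ncard = 0) (hn : M.E.ncard = 12) :
    {X : Set α | X ⊆ M.E ∧ X.ncard = 3 ∧ M.eRk X ≤ 2}.ncard ≤ 11 ∧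
    {X : Set α | X ⊆ M.E ∧ X.ncard = 4 ∧ M.eRk X ≤ 2}.ncard ≤ 5 ∧
    {X : Set α | X ⊆ M.E ∧ X.ncard = 4 ∧ M.IsCircuit X}.ncard ≤ 22 ∧
    {X : Set α | X ⊆ M.E ∧ X.ncard = 4 ∧ M.eRk X ≤ 3}.ncard ≤ 121 ∧
    {X : Set α | X ⊆ M.E ∧ X.ncard = 5 ∧ M.eRk X ≤ 2}.ncard ≤ 1 ∧
    {X : Set α | X ⊆ M.E ∧ X.ncard = 5 ∧ M.eRk X ≤ 3}.ncard ≤ 56 ∧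
    {X : Set α | X ⊆ M.E ∧ X.ncard = 5 ∧ M.eRk X ≤ 4}.ncard ≤ 418 := by
  have hr : (M.eRk M.E).toNat = 8 := by
    have := ncard_ground_eq_eRk_toNat_add M hd
    omega
  have h3 := triangles_le_eleven_of_nullity_four M hd hK h0 (by omega)
  have h42 := four_mul_ncard_four_eRk_le_two_le_mul M hK hd h0 (by omega)
  have h4 := ncard_fourCircuits_le_div M hK hd (by omega)
  have h4' : {X : Set α | X ⊆ M.E ∧ X.ncard = 4 ∧ M.IsCircuit X}.ncard ≤ 22 := by
    rw [hn] at h4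
    exact h4.trans (by decide)
  have hD4 := ncard_four_eRk_le_three_le_add M h0
  have h52 := five_mul_ncard_five_eRk_le_two_le_of_no_dep_pair M hK hd h0 (by omega)
  have h53 := five_mul_ncard_five_eRk_le_three_le M hK hd (by omega)
  have h54 := five_mul_ncard_five_eRk_le_four_le_exact M hK hd (by omega)
  rw [hn] at hD4 h53 h54
  rw [show Nat.choose 12 4 = 495 by decide] at h54
  omega

end S1CFG

end PercRepro
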